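import Summits.CriticalPhenomena.PercolationContinuityZ3.Theorems.PercLowPointHalfSpaceTallClusterMassBoundWallArmPartial

/-!
# `TallClusterMassBound` (stmt-CriticalPhenomena-0912), line `replica-overlap-cs-transfer` —
# the exact residual of `stub_wallArmLowerRegularity`: fixed-ratio extension, and the density of good scales

The registered stub `stub_wallArmLowerRegularity` is the two-scale LOWER regularity of the wall one-arm
`π_s(n) = armProb (criticalProbI 3) n` at `p_c(ℤ³)`:
`WallArmLowerRegularity := ∃ C, ∃ λ < 11/4, ∀ 1 ≤ n ≤ r, π_s(n) ≤ C (r/n)^λ π_s(r)`.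
No engine for it exists in `d = 3` (the 2D analogue is RSW gluing, the high-dimensional one Kozma–Nachmias).
This file pins down, sorry-free, WHAT EXACTLY is missing and how far one-scale information reaches.

* §1 `armProb_le_armProb_of_le` (monotonicity), `armProb_pow_mul_ge` (iterating a `b`-fold extension bound).
* §2 `wallArmLowerRegularity_of_pow_extension` : a uniform `2^k`-fold extension bound
  `π_s(2^k n) ≥ q π_s(n)` (`n ≥ n₀`) with `q > (2^k)^{-11/4}` for ONE fixed `k ≥ 1` implies the stub
  (`λ = log_{2^k}(1/q) < 11/4`; `k = 1` is the skeleton's doubling criterion).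
* §3 `pow_extension_of_wallArmLowerRegularity` : conversely the stub gives such a bound for some `k`
  (`q = (C 2^{kλ})⁻¹ > 2^{-11k/4}` for any `k` with `2^{k(11/4-λ)} > C`), whence the EQUIVALENCE
  `wallArmLowerRegularity_iff_pow_extension` (registered, binder-free): the residual open content of the stub is
  exactly "uniform `2^k`-fold extension of the wall arm beating the counting rate `2^{-11k/4}`, some fixed `k`".
  `doubling_of_wallArmLowerRegularity` : the stub forces uniform doubling with SOME constant `q₀ > 0`.
* §4 how far one-scale bounds reach: `armProb_two_pow_mul_le_pow_card` (the arm at scale `2^K n₀` is at most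
  `q^{#bad scales}`), `wallArm_badDoublingScales_le` (registered): by `π_s(m) ≥ 1/(588 m²)`
  (`armProb_criticalProbI_ge`) the number of dyadic scales `k < K` with `π_s(2^{k+1} n₀) < q π_s(2^k n₀)` is
  `≤ (log(588 n₀²) + K log 4) / log(1/q)`; at the lethal ratio `q = 2^{-11/4}` this is `(8/11) K + O(1)`
  (`wallArm_goodDoublingScales_ge`: at least `(3/11) K - O(1)` good scales). The stub needs control of the
  geometric mean of the ratios on EVERY long block of scales, which no count of good scales provides.
-/

noncomputable section

open MeasureTheory Finset Filter
open Literature.Probability.Percolation Literature.Probability.LatticeModels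
open Summit.CriticalPhenomena.PercolationContinuityZ3.Theorems.TallClusterMassBound.Negative
open Summit.CriticalPhenomena.PercolationContinuityZ3.Theorems.QuantitativeBGN.Negative

namespace Summit.CriticalPhenomena.PercolationContinuityZ3.Theorems.TallClusterMassBound.ReplicaOverlap

/-! ## §1 Monotonicity and iteration -/

/-- `π_s` is non-increasing in the radius (`arm r ⊆ arm n` for `n ≤ r`). [folklore] -/
theorem armProb_le_armProb_of_le (p : unitInterval) {n r : ℕ} (h : n ≤ r) : armProb p r ≤ armProb p n := by
  refine measureReal_mono ?_
  rintro ω ⟨y, ⟨i, hi⟩, hy⟩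
  exact ⟨y, ⟨i, le_trans (by exact_mod_cast h) hi⟩, hy⟩

/-- Iterating a `b`-fold extension bound: `q^j π(n) ≤ π(b^j n)` for `n ≥ n₀`. [folklore] -/
theorem armProb_pow_mul_ge {p : unitInterval} {q : ℝ} (hq : 0 ≤ q) {b n₀ : ℕ} (hb : 1 ≤ b)
    (h : ∀ n : ℕ, n₀ ≤ n → q * armProb p n ≤ armProb p (b * n)) :
    ∀ j n : ℕ, n₀ ≤ n → q ^ j * armProb p n ≤ armProb p (b ^ j * n)
  | 0, n, _ => by simp
  | j + 1, n, hn => by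
    have ih := armProb_pow_mul_ge hq hb h j n hn
    have hle : n₀ ≤ b ^ j * n := le_trans hn (Nat.le_mul_of_pos_left n (pow_pos hb j))
    calc q ^ (j + 1) * armProb p n = q * (q ^ j * armProb p n) := by ring
      _ ≤ q * armProb p (b ^ j * n) := mul_le_mul_of_nonneg_left ih hq
      _ ≤ armProb p (b * (b ^ j * n)) := h _ hle
      _ = armProb p (b ^ (j + 1) * n) := by rw [pow_succ]; congr 1; ring

/-! ## §2 Fixed-ratio extension ⟹ the stub -/

/-- **`2^k`-FOLD EXTENSION CRITERION ⟹ STUB.** If for one fixed `k ≥ 1`, some `q > (2^k)^{-11/4}` and all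
`n ≥ n₀ ≥ 1` the wall arm extends its radius `2^k`-fold at conditional cost `≥ q`, i.e.
`q π_s(n) ≤ π_s(2^k n)` at `p_c(ℤ³)`, then `stub_wallArmLowerRegularity` holds with `λ = log_{2^k}(1/q) < 11/4`
and `C = (q π_s(n₀))⁻¹`. (`k = 1`: the skeleton's doubling criterion.) [folklore] -/
theorem wallArmLowerRegularity_of_pow_extension {k : ℕ} (hk : 1 ≤ k) {q₀ : ℝ}
    (hq : (((2 : ℝ) ^ k) ^ ((11 : ℝ) / 4))⁻¹ < q₀) {n₀ : ℕ} (hn₀ : 1 ≤ n₀)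
    (h : ∀ n : ℕ, n₀ ≤ n → q₀ * armProb (criticalProbI 3) n ≤ armProb (criticalProbI 3) (2 ^ k * n)) :
    ∃ C lam : ℝ, lam < (11 : ℝ) / 4 ∧ ∀ n r : ℕ, 1 ≤ n → n ≤ r →
      armProb (criticalProbI 3) n ≤ C * ((r : ℝ) / n) ^ lam * armProb (criticalProbI 3) r := by
  set p : unitInterval := criticalProbI 3 with hp
  set b : ℕ := 2 ^ k with hb
  have hb2 : 2 ≤ b := by
    calc 2 = 2 ^ 1 := by norm_num
      _ ≤ 2 ^ k := Nat.pow_le_pow_right (by norm_num) hk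
  have hb1 : 1 < b := by omega
  have hbR : ((b : ℕ) : ℝ) = (2 : ℝ) ^ k := by rw [hb]; push_cast; ring
  have hbR1 : (1 : ℝ) < b := by exact_mod_cast hb1
  have hbpos : (0 : ℝ) < b := by positivity
  have hBpos : (0 : ℝ) < (b : ℝ) ^ ((11 : ℝ) / 4) := Real.rpow_pos_of_pos hbpos _
  have hq' : ((b : ℝ) ^ ((11 : ℝ) / 4))⁻¹ < q₀ := by rwa [hbR]
  have hq0 : 0 < q₀ := lt_trans (inv_pos.2 hBpos) hq'
  have hπ0 : 0 < armProb p n₀ := armProb_criticalProbI_pos n₀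
  -- q₀ ≤ 1, since π(b n₀) ≤ π(n₀)
  have hq1 : q₀ ≤ 1 := by
    have h1 := h n₀ le_rfl
    have h2 : armProb p (b * n₀) ≤ armProb p n₀ :=
      armProb_le_armProb_of_le p (Nat.le_mul_of_pos_left n₀ (by omega))
    nlinarith
  set lam : ℝ := Real.logb b q₀⁻¹ with hlam
  have hqinv1 : 1 ≤ q₀⁻¹ := one_le_inv_iff₀.2 ⟨hq0, hq1⟩
  have hlam0 : 0 ≤ lam := Real.logb_nonneg hbR1 hqinv1
  have hlam_lt : lam < (11 : ℝ) / 4 := by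
    rw [hlam, Real.logb_lt_iff_lt_rpow hbR1 (inv_pos.2 hq0), inv_lt_comm₀ hq0 hBpos]
    exact hq'
  have hblam : (b : ℝ) ^ lam = q₀⁻¹ := by
    rw [hlam, Real.rpow_logb hbpos hbR1.ne' (inv_pos.2 hq0)]
  -- the regular case n ≥ n₀
  have main : ∀ n r : ℕ, n₀ ≤ n → n ≤ r →
      armProb p n ≤ q₀⁻¹ * ((r : ℝ) / n) ^ lam * armProb p r := by
    intro n r hn hnr
    have hn1 : 1 ≤ n := le_trans hn₀ hn
    have hnpos : 0 < n := hn1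
    have hn0r : (0 : ℝ) < n := by exact_mod_cast hn1
    set j : ℕ := Nat.log b (r / n) with hj
    have hq1' : 1 ≤ r / n := (Nat.le_div_iff_mul_le hnpos).2 (by simpa using hnr)
    have hj1 : b ^ j ≤ r / n := Nat.pow_log_le_self b (by omega)
    have hj2 : r / n < b ^ (j + 1) := Nat.lt_pow_succ_log_self hb1 _
    have hr_lt : r < b ^ (j + 1) * n := by
      have := (Nat.div_lt_iff_lt_mul hnpos).1 hj2
      linarith [Nat.mul_comm (b ^ (j + 1)) n]
    -- π(r) ≥ π(b^{j+1} n) ≥ q₀^{j+1} π(n)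
    have hchain : q₀ ^ (j + 1) * armProb p n ≤ armProb p r :=
      le_trans (armProb_pow_mul_ge hq0.le (by omega) h (j + 1) n hn)
        (armProb_le_armProb_of_le p hr_lt.le)
    -- (q₀⁻¹)^j = (b^j)^lam ≤ (r/n)^lam
    have hpowj : (q₀⁻¹) ^ j = ((b : ℝ) ^ j) ^ lam := by
      rw [← hblam, ← Real.rpow_natCast ((b : ℝ) ^ lam) j, ← Real.rpow_mul hbpos.le,
        mul_comm, Real.rpow_mul hbpos.le, Real.rpow_natCast]
    have hbj_le : ((b : ℝ) ^ j) ≤ (r : ℝ) / n := by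
      have h1 : ((b ^ j : ℕ) : ℝ) ≤ ((r / n : ℕ) : ℝ) := by exact_mod_cast hj1
      have h2 : ((r / n : ℕ) : ℝ) ≤ (r : ℝ) / n := Nat.cast_div_le
      push_cast at h1
      exact h1.trans h2
    have hfac : (q₀⁻¹) ^ j ≤ ((r : ℝ) / n) ^ lam := by
      rw [hpowj]
      exact Real.rpow_le_rpow (by positivity) hbj_le hlam0
    have hπr := armProb_nonneg p r
    have hqj0 : 0 < q₀ ^ (j + 1) := pow_pos hq0 _
    calc armProb p n = (q₀ ^ (j + 1))⁻¹ * (q₀ ^ (j + 1) * armProb p n) := by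
          field_simp
      _ ≤ (q₀ ^ (j + 1))⁻¹ * armProb p r := mul_le_mul_of_nonneg_left hchain (by positivity)
      _ = q₀⁻¹ * (q₀⁻¹) ^ j * armProb p r := by rw [← inv_pow, pow_succ]; ring
      _ ≤ q₀⁻¹ * ((r : ℝ) / n) ^ lam * armProb p r := by
          have hqi0 : 0 ≤ q₀⁻¹ := by positivity
          exact mul_le_mul_of_nonneg_right (mul_le_mul_of_nonneg_left hfac hqi0) hπr
  refine ⟨(q₀ * armProb p n₀)⁻¹, lam, hlam_lt, fun n r hn hnr => ?_⟩
  have hC : q₀⁻¹ ≤ (q₀ * armProb p n₀)⁻¹ := by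
    rw [mul_inv]
    have : 1 ≤ (armProb p n₀)⁻¹ := one_le_inv_iff₀.2 ⟨hπ0, armProb_le_one p n₀⟩
    have hqi0 : 0 ≤ q₀⁻¹ := by positivity
    nlinarith
  have hn0r : (0 : ℝ) < n := by exact_mod_cast hn
  have hrn1 : 1 ≤ (r : ℝ) / n := by
    rw [le_div_iff₀ hn0r, one_mul]; exact_mod_cast hnr
  have hfac1 : 1 ≤ ((r : ℝ) / n) ^ lam := Real.one_le_rpow hrn1 hlam0
  have hπr := armProb_nonneg p r
  rcases le_or_gt n₀ n with hn₀n | hnn₀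
  · -- regular case
    calc armProb p n ≤ q₀⁻¹ * ((r : ℝ) / n) ^ lam * armProb p r := main n r hn₀n hnr
      _ ≤ (q₀ * armProb p n₀)⁻¹ * ((r : ℝ) / n) ^ lam * armProb p r := by
          have h0 : 0 ≤ ((r : ℝ) / n) ^ lam * armProb p r := by positivity
          nlinarith [mul_le_mul_of_nonneg_right hC h0]
  · -- small n < n₀
    have hπn1 : armProb p n ≤ 1 := armProb_le_one p n
    rcases le_or_gt n₀ r with hn₀r | hrn₀
    · have hm := main n₀ r le_rfl hn₀r
      have hratio : ((r : ℝ) / n₀) ^ lam ≤ ((r : ℝ) / n) ^ lam := by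
        refine Real.rpow_le_rpow (by positivity) ?_ hlam0
        exact div_le_div_of_nonneg_left (by positivity) hn0r (by exact_mod_cast hnn₀.le)
      have key : armProb p n₀ ≤ q₀⁻¹ * ((r : ℝ) / n) ^ lam * armProb p r :=
        hm.trans (mul_le_mul_of_nonneg_right
          (mul_le_mul_of_nonneg_left hratio (by positivity)) hπr)
      have key2 : 1 ≤ (armProb p n₀)⁻¹ * (q₀⁻¹ * ((r : ℝ) / n) ^ lam * armProb p r) := by
        rw [← inv_mul_cancel₀ hπ0.ne']
        exact mul_le_mul_of_nonneg_left key (by positivity)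
      calc armProb p n ≤ 1 := hπn1
        _ ≤ (armProb p n₀)⁻¹ * (q₀⁻¹ * ((r : ℝ) / n) ^ lam * armProb p r) := key2
        _ = (q₀ * armProb p n₀)⁻¹ * ((r : ℝ) / n) ^ lam * armProb p r := by rw [mul_inv]; ring
    · have hπrn₀ : armProb p n₀ ≤ armProb p r := armProb_le_armProb_of_le p hrn₀.le
      have key2 : 1 ≤ (armProb p n₀)⁻¹ * armProb p r := by
        rw [← inv_mul_cancel₀ hπ0.ne']
        exact mul_le_mul_of_nonneg_left hπrn₀ (by positivity)
      calc armProb p n ≤ 1 := hπn1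
        _ ≤ (armProb p n₀)⁻¹ * armProb p r := key2
        _ ≤ q₀⁻¹ * ((r : ℝ) / n) ^ lam * ((armProb p n₀)⁻¹ * armProb p r) := by
            have h0 : 0 ≤ (armProb p n₀)⁻¹ * armProb p r := by positivity
            have h1 : (1 : ℝ) ≤ q₀⁻¹ * ((r : ℝ) / n) ^ lam :=
              one_le_mul_of_one_le_of_one_le hqinv1 hfac1
            simpa using mul_le_mul_of_nonneg_right h1 h0
        _ = (q₀ * armProb p n₀)⁻¹ * ((r : ℝ) / n) ^ lam * armProb p r := by rw [mul_inv]; ring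

/-! ## §3 The stub ⟹ fixed-ratio extension; the equivalence -/

/-- Any witness `(C, λ)` of the stub has `C ≥ 1` (take `n = r = 1`; `π_s(1) > 0`). [folklore] -/
theorem one_le_const_of_wallArmLowerRegularity {C lam : ℝ}
    (hW : ∀ n r : ℕ, 1 ≤ n → n ≤ r →
      armProb (criticalProbI 3) n ≤ C * ((r : ℝ) / n) ^ lam * armProb (criticalProbI 3) r) : 1 ≤ C := by
  have h := hW 1 1 le_rfl le_rfl
  have hπ := armProb_criticalProbI_pos 1
  simp only [Nat.cast_one, div_one, Real.one_rpow, mul_one] at h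
  nlinarith

/-- **STUB ⟹ `2^k`-FOLD EXTENSION** for some `k`: from `π_s(n) ≤ C (r/n)^λ π_s(r)`,
`λ < 11/4`, pick `k ≥ 1` with `2^{k(11/4-λ)} > C`; then `q := (C 2^{kλ})⁻¹ > (2^k)^{-11/4}` and
`q π_s(n) ≤ π_s(2^k n)` for all `n ≥ 1`. [folklore] -/
theorem pow_extension_of_wallArmLowerRegularity {C lam : ℝ} (hlam : lam < (11 : ℝ) / 4)
    (hW : ∀ n r : ℕ, 1 ≤ n → n ≤ r →
      armProb (criticalProbI 3) n ≤ C * ((r : ℝ) / n) ^ lam * armProb (criticalProbI 3) r) :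
    ∃ k : ℕ, 1 ≤ k ∧ ∃ q : ℝ, (((2 : ℝ) ^ k) ^ ((11 : ℝ) / 4))⁻¹ < q ∧ ∃ n₀ : ℕ, 1 ≤ n₀ ∧
      ∀ n : ℕ, n₀ ≤ n → q * armProb (criticalProbI 3) n ≤ armProb (criticalProbI 3) (2 ^ k * n) := by
  have hC1 : 1 ≤ C := one_le_const_of_wallArmLowerRegularity hW
  have hC0 : 0 < C := by linarith
  set δ : ℝ := (11 : ℝ) / 4 - lam with hδdef
  have hδ : 0 < δ := by rw [hδdef]; linarith
  set B : ℝ := (2 : ℝ) ^ δ with hB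
  have hB1 : 1 < B := Real.one_lt_rpow (by norm_num) hδ
  obtain ⟨k₀, hk₀⟩ := pow_unbounded_of_one_lt C hB1
  set k : ℕ := max k₀ 1 with hk
  have hk1 : 1 ≤ k := le_max_right _ _
  have hCk : C < B ^ k := lt_of_lt_of_le hk₀ (pow_le_pow_right₀ hB1.le (le_max_left _ _))
  set b : ℝ := (2 : ℝ) ^ k with hb
  have hb0 : 0 < b := by positivity
  have hBk : B ^ k = b ^ δ := by
    rw [hB, hb, ← Real.rpow_natCast ((2 : ℝ) ^ δ) k, ← Real.rpow_mul (by norm_num),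
      ← Real.rpow_natCast (2 : ℝ) k, ← Real.rpow_mul (by norm_num), mul_comm]
  have hblam : 0 < b ^ lam := Real.rpow_pos_of_pos hb0 _
  refine ⟨k, hk1, (C * b ^ lam)⁻¹, ?_, 1, le_rfl, fun n hn => ?_⟩
  · rw [inv_lt_inv₀ (Real.rpow_pos_of_pos hb0 _) (mul_pos hC0 hblam)]
    have hsplit : b ^ ((11 : ℝ) / 4) = b ^ δ * b ^ lam := by
      rw [← Real.rpow_add hb0]; congr 1; rw [hδdef]; ring
    rw [hsplit, ← hBk]
    exact mul_lt_mul_of_pos_right hCk hblam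
  · have hn0 : (0 : ℝ) < n := by exact_mod_cast hn
    have hw := hW n (2 ^ k * n) hn (Nat.le_mul_of_pos_left n (by positivity))
    have hratio : (((2 ^ k * n : ℕ) : ℝ) / n) = b := by
      rw [hb]; push_cast; field_simp
    rw [hratio] at hw
    calc (C * b ^ lam)⁻¹ * armProb (criticalProbI 3) n
        ≤ (C * b ^ lam)⁻¹ * (C * b ^ lam * armProb (criticalProbI 3) (2 ^ k * n)) :=
          mul_le_mul_of_nonneg_left hw (by positivity)
      _ = armProb (criticalProbI 3) (2 ^ k * n) := by
          field_simp

/-- **The stub forces uniform doubling with SOME constant**: `∃ q₀ > 0, ∀ n ≥ 1, q₀ π_s(n) ≤ π_s(2n)`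
(`q₀ = (C 2^λ)⁻¹`; no threshold). So the stub sits between uniform doubling with `q₀ > 2^{-11/4}` (sufficient)
and uniform doubling with some `q₀ > 0` (necessary); §3's equivalence locates it exactly. [folklore] -/
theorem doubling_of_wallArmLowerRegularity {C lam : ℝ}
    (hW : ∀ n r : ℕ, 1 ≤ n → n ≤ r →
      armProb (criticalProbI 3) n ≤ C * ((r : ℝ) / n) ^ lam * armProb (criticalProbI 3) r) :
    ∃ q₀ : ℝ, 0 < q₀ ∧ ∀ n : ℕ, 1 ≤ n →
      q₀ * armProb (criticalProbI 3) n ≤ armProb (criticalProbI 3) (2 * n) := by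
  have hC1 : 1 ≤ C := one_le_const_of_wallArmLowerRegularity hW
  have hC0 : 0 < C := by linarith
  have h2lam : 0 < (2 : ℝ) ^ lam := Real.rpow_pos_of_pos (by norm_num) _
  refine ⟨(C * (2 : ℝ) ^ lam)⁻¹, by positivity, fun n hn => ?_⟩
  have hn0 : (0 : ℝ) < n := by exact_mod_cast hn
  have hw := hW n (2 * n) hn (by omega)
  have hratio : (((2 * n : ℕ) : ℝ) / n) = 2 := by push_cast; field_simp
  rw [hratio] at hw
  calc (C * (2 : ℝ) ^ lam)⁻¹ * armProb (criticalProbI 3) n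
      ≤ (C * (2 : ℝ) ^ lam)⁻¹ * (C * (2 : ℝ) ^ lam * armProb (criticalProbI 3) (2 * n)) :=
        mul_le_mul_of_nonneg_left hw (by positivity)
    _ = armProb (criticalProbI 3) (2 * n) := by field_simp

/-- **EQUIVALENCE (registered, binder-free): the stub `stub_wallArmLowerRegularity` holds iff for ONE fixed
`k ≥ 1` the wall arm at `p_c(ℤ³)` extends `2^k`-fold at a uniform conditional cost `q > (2^k)^{-11/4}`:
`∃ k ≥ 1, ∃ q > ((2^k)^{11/4})⁻¹, ∃ n₀ ≥ 1, ∀ n ≥ n₀, q π_s(n) ≤ π_s(2^k n)`.** This is the exact residual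
open content of the stub (no named fact in the tree or in print proves the right-hand side for any `k`;
`d = 3` half-space arm extension). [folklore] -/
theorem wallArmLowerRegularity_iff_pow_extension :
    (∃ C lam : ℝ, lam < (11 : ℝ) / 4 ∧ ∀ n r : ℕ, 1 ≤ n → n ≤ r →
      armProb (criticalProbI 3) n ≤ C * ((r : ℝ) / n) ^ lam * armProb (criticalProbI 3) r) ↔
    (∃ k : ℕ, 1 ≤ k ∧ ∃ q : ℝ, (((2 : ℝ) ^ k) ^ ((11 : ℝ) / 4))⁻¹ < q ∧ ∃ n₀ : ℕ, 1 ≤ n₀ ∧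
      ∀ n : ℕ, n₀ ≤ n → q * armProb (criticalProbI 3) n ≤ armProb (criticalProbI 3) (2 ^ k * n)) := by
  constructor
  · rintro ⟨C, lam, hlam, hW⟩
    exact pow_extension_of_wallArmLowerRegularity hlam hW
  · rintro ⟨k, hk, q, hq, n₀, hn₀, h⟩
    exact wallArmLowerRegularity_of_pow_extension hk hq hn₀ h

/-! ## §4 How far one-scale information reaches: counting bad dyadic scales -/

/-- Along the dyadic scales `2^k n₀`, the arm probability at scale `2^K n₀` is at most `q^{#bad}`, where a
scale `k < K` is BAD if `π_s(2^{k+1} n₀) < q π_s(2^k n₀)` (good scales cost at most the factor `1`,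
`π_s(n₀) ≤ 1`). [folklore] -/
theorem armProb_two_pow_mul_le_pow_card {q : ℝ} (hq : 0 ≤ q) (n₀ : ℕ) :
    ∀ K : ℕ, armProb (criticalProbI 3) (2 ^ K * n₀) ≤
      q ^ (Finset.filter (fun k => armProb (criticalProbI 3) (2 ^ (k + 1) * n₀) <
          q * armProb (criticalProbI 3) (2 ^ k * n₀)) (Finset.range K)).card
  | 0 => by simpa using armProb_le_one (criticalProbI 3) n₀
  | K + 1 => by
    have ih := armProb_two_pow_mul_le_pow_card hq n₀ K
    have hK : K ∉ Finset.filter (fun k => armProb (criticalProbI 3) (2 ^ (k + 1) * n₀) <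
        q * armProb (criticalProbI 3) (2 ^ k * n₀)) (Finset.range K) := by simp
    rw [Finset.range_add_one, Finset.filter_insert]
    split_ifs with hbad
    · rw [Finset.card_insert_of_notMem hK, pow_succ]
      calc armProb (criticalProbI 3) (2 ^ (K + 1) * n₀)
          ≤ q * armProb (criticalProbI 3) (2 ^ K * n₀) := hbad.le
        _ ≤ q * q ^ _ := mul_le_mul_of_nonneg_left ih hq
        _ = q ^ _ * q := mul_comm _ _
    · calc armProb (criticalProbI 3) (2 ^ (K + 1) * n₀)
          ≤ armProb (criticalProbI 3) (2 ^ K * n₀) :=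
            armProb_le_armProb_of_le _ (Nat.mul_le_mul_right _ (Nat.pow_le_pow_right (by norm_num) K.le_succ))
        _ ≤ _ := ih

/-- **BAD SCALES ARE AT MOST A `log 4 / log(1/q)` FRACTION (registered, binder-free).** At `p_c(ℤ³)`, for
`0 < q < 1`, `n₀ ≥ 1` and every `K`, the number of dyadic scales `k < K` with `π_s(2^{k+1} n₀) < q π_s(2^k n₀)`
is at most `(log(588 n₀²) + K log 4) / log(1/q)`: indeed `1/(588 (2^K n₀)²) ≤ π_s(2^K n₀) ≤ q^{#bad}`
(`armProb_criticalProbI_ge`, `armProb_two_pow_mul_le_pow_card`). For `q < 1/4` the bad scales have upper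
density `< 1`; this sharpens "ratio `≥ q` infinitely often" (`doubling_ratio_ge_io`) to a density statement and is
all that one-scale bounds can say. [folklore] -/
theorem wallArm_badDoublingScales_le :
    ∀ (q : ℝ), 0 < q → q < 1 → ∀ n₀ K : ℕ, 1 ≤ n₀ →
      ((Finset.filter (fun k => armProb (criticalProbI 3) (2 ^ (k + 1) * n₀) <
          q * armProb (criticalProbI 3) (2 ^ k * n₀)) (Finset.range K)).card : ℝ) ≤
        (Real.log (588 * (n₀ : ℝ) ^ 2) + K * Real.log 4) / Real.log q⁻¹ := by
  intro q hq0 hq1 n₀ K hn₀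
  set Bd : ℕ := (Finset.filter (fun k => armProb (criticalProbI 3) (2 ^ (k + 1) * n₀) <
      q * armProb (criticalProbI 3) (2 ^ k * n₀)) (Finset.range K)).card with hBd
  have hup : armProb (criticalProbI 3) (2 ^ K * n₀) ≤ q ^ Bd := armProb_two_pow_mul_le_pow_card hq0.le n₀ K
  have hm : 1 ≤ 2 ^ K * n₀ := le_trans hn₀ (Nat.le_mul_of_pos_left n₀ (pow_pos (by norm_num) K))
  have hlow := armProb_criticalProbI_ge hm
  have hn0 : (0 : ℝ) < n₀ := by exact_mod_cast hn₀
  have hcast : ((2 ^ K * n₀ : ℕ) : ℝ) = (2 : ℝ) ^ K * n₀ := by push_cast; ring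
  rw [hcast] at hlow
  have hpos : (0 : ℝ) < 588 * ((2 : ℝ) ^ K * n₀) ^ 2 := by positivity
  -- 1 ≤ 588 n₀² 4^K q^Bd
  have hkey : 1 ≤ 588 * (n₀ : ℝ) ^ 2 * (4 : ℝ) ^ K * q ^ Bd := by
    have h1 : 1 / (588 * ((2 : ℝ) ^ K * n₀) ^ 2) ≤ q ^ Bd := hlow.trans hup
    rw [div_le_iff₀ hpos] at h1
    have hid : q ^ Bd * (588 * ((2 : ℝ) ^ K * n₀) ^ 2) = 588 * (n₀ : ℝ) ^ 2 * (4 : ℝ) ^ K * q ^ Bd := by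
      rw [mul_pow, ← pow_mul, show (2 : ℝ) ^ (K * 2) = 4 ^ K by rw [mul_comm, pow_mul]; norm_num]
      ring
    rwa [hid] at h1
  -- take logarithms
  have hA : 0 < 588 * (n₀ : ℝ) ^ 2 := by positivity
  have h4K : 0 < (4 : ℝ) ^ K := by positivity
  have hqB : 0 < q ^ Bd := pow_pos hq0 _
  have hlog : 0 ≤ Real.log (588 * (n₀ : ℝ) ^ 2) + K * Real.log 4 + Bd * Real.log q := by
    have := Real.log_nonneg hkey
    rwa [Real.log_mul (mul_pos hA h4K).ne' hqB.ne', Real.log_mul hA.ne' h4K.ne', Real.log_pow,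
      Real.log_pow] at this
  have hlq : 0 < Real.log q⁻¹ := Real.log_pos (one_lt_inv_iff₀.2 ⟨hq0, hq1⟩)
  rw [le_div_iff₀ hlq, Real.log_inv]
  linarith

/-- **At the lethal ratio `2^{-11/4}`, at least `3K/11 - O(1)` of the first `K` dyadic scales are good.**
For `n₀ ≥ 1` and every `K`: `#{k < K : 2^{-11/4} π_s(2^k n₀) ≤ π_s(2^{k+1} n₀)} ≥ (3/11) K -
log(588 n₀²)/((11/4) log 2)` (`log 4 / log 2^{11/4} = 8/11`). The stub needs the geometric mean of the
ratios over EVERY block of consecutive scales to exceed `2^{-11/4}` up to a uniform constant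
(`wallArmLowerRegularity_iff_pow_extension`); a density of good scales does not give that. [folklore] -/
theorem wallArm_goodDoublingScales_ge (n₀ K : ℕ) (hn₀ : 1 ≤ n₀) :
    (3 / 11 : ℝ) * K - Real.log (588 * (n₀ : ℝ) ^ 2) / ((11 / 4) * Real.log 2) ≤
      ((Finset.filter (fun k => ((2 : ℝ) ^ ((11 : ℝ) / 4))⁻¹ * armProb (criticalProbI 3) (2 ^ k * n₀) ≤
          armProb (criticalProbI 3) (2 ^ (k + 1) * n₀)) (Finset.range K)).card : ℝ) := by
  set q : ℝ := ((2 : ℝ) ^ ((11 : ℝ) / 4))⁻¹ with hq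
  have h2pow : (1 : ℝ) < (2 : ℝ) ^ ((11 : ℝ) / 4) := Real.one_lt_rpow (by norm_num) (by norm_num)
  have hq0 : 0 < q := by positivity
  have hq1 : q < 1 := inv_lt_one_of_one_lt₀ h2pow
  have hbad := wallArm_badDoublingScales_le q hq0 hq1 n₀ K hn₀
  have hlogq : Real.log q⁻¹ = (11 / 4) * Real.log 2 := by
    rw [hq, inv_inv, Real.log_rpow (by norm_num)]
  have hlog4 : Real.log 4 = 2 * Real.log 2 := by
    rw [show (4 : ℝ) = 2 ^ 2 by norm_num, Real.log_pow]; norm_num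
  rw [hlogq, hlog4] at hbad
  -- good + bad = K
  have hsum := Finset.card_filter_add_card_filter_not
    (s := Finset.range K) (p := fun k => armProb (criticalProbI 3) (2 ^ (k + 1) * n₀) <
      q * armProb (criticalProbI 3) (2 ^ k * n₀))
  rw [Finset.card_range] at hsum
  have hgood : (Finset.filter (fun k => ¬ (armProb (criticalProbI 3) (2 ^ (k + 1) * n₀) <
      q * armProb (criticalProbI 3) (2 ^ k * n₀))) (Finset.range K)) =
      Finset.filter (fun k => q * armProb (criticalProbI 3) (2 ^ k * n₀) ≤
        armProb (criticalProbI 3) (2 ^ (k + 1) * n₀)) (Finset.range K) :=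
    Finset.filter_congr fun k _ => not_lt
  rw [hgood] at hsum
  have hsumR : ((Finset.filter (fun k => armProb (criticalProbI 3) (2 ^ (k + 1) * n₀) <
      q * armProb (criticalProbI 3) (2 ^ k * n₀)) (Finset.range K)).card : ℝ) +
      ((Finset.filter (fun k => q * armProb (criticalProbI 3) (2 ^ k * n₀) ≤
        armProb (criticalProbI 3) (2 ^ (k + 1) * n₀)) (Finset.range K)).card : ℝ) = K := by
    exact_mod_cast hsum
  have hlog2 : 0 < Real.log 2 := Real.log_pos (by norm_num)
  have hden : (0 : ℝ) < 11 / 4 * Real.log 2 := by positivity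
  -- bad ≤ L/den + (8/11) K
  have hbad' : ((Finset.filter (fun k => armProb (criticalProbI 3) (2 ^ (k + 1) * n₀) <
      q * armProb (criticalProbI 3) (2 ^ k * n₀)) (Finset.range K)).card : ℝ) ≤
      Real.log (588 * (n₀ : ℝ) ^ 2) / (11 / 4 * Real.log 2) + (8 / 11) * K := by
    refine hbad.trans (le_of_eq ?_)
    field_simp
    ring
  linarith

end Summit.CriticalPhenomena.PercolationContinuityZ3.Theorems.TallClusterMassBound.ReplicaOverlap
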